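import Literature.MathematicalPhysics.QuantumFieldTheory.Balaban1983to89.T4BetaReadOutLipschitz

/-!
# T4BetaReadOutWitness — node U2's DEPENDENT BOOKING «NE4 = (R) ∘ {NE5, NE9}» IS NON-VACUOUS AND NON-DEGENERATE:
an explicit toy scheme on which every binder of `T4BetaReadOutLipschitz.Probes.ne4_of_u3_recipe` and of
`T4BetaReadOutLipschitz.injectedRate_of_u3_on` holds with finite constants (nonzero except the decay weight κ, which the
end-to-end §4 instance CHOOSES 0 because the toy pin weight d ≡ 0), the β-functions READ OFF the scheme
are HISTORY-DEPENDENT with FADING MEMORY and a GENUINE (nonzero) scale shift, and both theorems fire BY NAME — down to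
`T4CauchySum.InjectedRate (1/8) 0 (1/2)` for the two-run discrepancies of actual solutions of the recursion (0.20)
(cell `pub-balaban`, T4-DAG v20 §2 node U2 / §6 NE4; journal row T4-U2.NE4-PROVE-P1g*; a WITNESS, NO estimate of the
cell's NEW-ESTIMATE kind, NOT an instance of Bałaban's activities).

HONEST FRAMING (T4-DAG PAGE 1).  The cell's T4 target is rung (B)+1: existence AND uniqueness of the ε → 0 limit of
Bałaban's unit-scale averaged expectations on a FIXED finite torus — strictly beyond ultraviolet stability
([Balaban1988Convergent] Cor. 3 p. 264; [Balaban1989LargeFieldII] Thm 1 p. 355), and NOT infinite volume, NOT a mass gap,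
NOT the Clay problem.  This module ASSERTS NOTHING about Bałaban's functionals.  It answers ONE bookkeeping question raised
by the cell's readers about node U2's liaison theorems (GAPS A-ne4p1-17; cross-read C-pv03-70 INFO 1; the referee's standing
demand that binder lists be shown inhabited, G-t4r3-1): ARE THE ELEVEN HYPOTHESES OF `ne4_of_u3_recipe` (window, NE5 for
every datum, NE9, fading memory, RepresentsA, RepresentsB, analyticity of both slice families on the chart ball, α > 0,
locality sum, non-empty probe sets) JOINTLY SATISFIABLE BY DATA ON WHICH THE CONCLUSION HAS CONTENT — a β that depends on
the whole coupling history, shifts under the scale shift, and is read through a genuine complex-analytic second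
derivative?  Answer (kernel): YES — §§1–4 below.  ABSOLUTE RULE of the cell honoured: no internally-minted statement enters
as a cited fact; the toy is DEFINED here and everything about it is PROVED here; the manuscripts under audit are named for
STRUCTURE only (which printed formula each toy object caricatures), never for a disputed step.

## What is typed and proved (all [folklore]: elementary real/complex analysis on an explicit toy)

§1 THE TOY SCHEME (definitions): carriers `toyC` (domains `ℕ`, scale n ↦ n + 1, tree length d ≡ 0, both background
   sorts `ℂ × Bool` = (chart point, Re/Im tag), gauge ≡ 0, transport = identity); the FADING-MEMORY ACCUMULATOR
   `mem ω g : ℕ → ℝ`, `mem ω g 0 = 0`, `mem ω g (s+1) = ω · (mem ω g s + g s)` (= Σ_{i<s} ω^{s−i} g_i, `mem_eq_sum`) — the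
   discrete fading-memory recursion that is this prover seat's assigned technique, here as the MODEL of how the preceding
   couplings enter a scale-s term ([Balaban1987RG1] p. 298: *dependence on all preceding coupling constants*, structure
   only); the cut-off square `cutSq A = A²` on the open unit chart ball, `0` outside (so every bound below is uniform over
   ALL backgrounds of the carrier while analyticity holds exactly on the ball — the (4.4)-type situation of
   `Probes.Analytic`); the ACTIVITIES `act ω c₀ g X A = (c₀ + mem ω g (X+1)) · cutSq A`; run A's functional
   `EA ω c₀ = tagSlice ∘ act` (the ENCODING CONVENTION of `T4BetaReadOutLipschitz` §5); run B's functional by the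
   PREPEND–SHIFT CONVENTION `EB ω c₀ b g U X = EA ω c₀ (prepend b g) U (X+1)` (run B = run A with the extra finest coupling
   `b` prepended, read one scale up — the re-indexing of `T4BetaReadOut.RepresentsB`); ONE PROBE PER STEP `toyP wt`
   (domain k at step k, both directions `1 ∈ ℂ`, weight wt; `T4BetaReadOutLipschitz.tagged`); the β-family
   `toyβ ω c₀ wt k v := (toyP wt).transportTo.recipe k (EA ω c₀ (extd v))` (so `RepresentsA` holds by definition).
§2 KERNEL FACTS ABOUT THE TOY: `mem_prepend` (prepending b and reading one scale up adds exactly ω^{s+1}·b),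
   `abs_mem_sub_le` (history Lipschitz bound Σ_{i<s} ω^{s−i}∣g_i − g'_i∣), `mem_nonneg`, `mem_le` (≤ ωγ/(1−ω) on the
   window, by the recursion — discrete Grönwall); `mixedDeriv_mul_cutSq` (the (4.3)-type mixed derivative
   `B12Decay510.mixedDeriv (m · cutSq) 1 1 = 2m`, Mathlib calculus); `analyticOnNhd_mul_cutSq`; the chart functions of both
   runs ARE the activities (`transportTo_cplx_EA`, `cplx_EB`, via `Probes.cplx_of_encodes`); the recipe in CLOSED FORM
   `recipeA_apply` / `recipeB_apply` (= 2wt(c₀ + mem …)); hence `toyβ_apply`: β_{k+1}(v_0, …, v_k) = 2wt(c₀ + Σ_i ω^{k+1−i} v_i).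
§3 EVERY BINDER OF `ne4_of_u3_recipe` HOLDS ON THE TOY (kernel): `ne5_toy` (NE5 for every datum b ∈ ]0, γ], C₅ = γω,
   θ = ω), `ne9_toy` (NE9 with moduli `Λω ω s i = ω^{s−i}`), `fadingMemory_toy` (C₉ = 1), `representsA_toy`,
   `representsB_toy` (by `mem_prepend` + `T4FlagMemory.extd_tail`), `analyticA_toy`, `analyticB_toy`, `localitySum_toy`
   (K = ∣wt∣), `idx_nonempty`; bonus `decayBound_toy` (the printed-form binder (1.18) of `T4OutputRate.DecayBound` also
   holds, E₀ = c₀ + ωγ/(1−ω)).  CONSEQUENCE BY NAME: `u2_triple_toy` = `Probes.ne4_of_u3_recipe` applied to the toy —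
   `ScaleShiftRate (8∣wt∣·γω·ω) ω γ (toyβ …) ∧ HistLipschitz (8∣wt∣·ω^{k+1−i}) γ (toyβ …) ∧ FadingMemory (8∣wt∣·ω) ω (…)`.
§4 NON-DEGENERACY + END TO END (kernel), at the numbers ω = θ = 1/4, c₀ = wt = 1, γ = 1/16, ρ = 1/2, b = 2, k₀ = 0, κ = 0:
   `βw_apply` (closed form), `βw_scaleShift` (β_{k+2}(w) − β_{k+1}(tail w) = 2·(1/4)^{k+2}·w₀ EXACTLY — nonzero, positive
   on the box: `βw_scaleShift_pos`; so NE4's content is genuine on the toy and the rate θ = ω is attained),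
   `βw_oldest` (β_2 depends on the OLDEST coupling: not last-only), `ne5_toy_not_zero` (the two runs' functionals are NOT
   equal: NE5 fails with C₅ = 0), `βw_lower`/`βw_upper`/`βw_cont` (2 ≤ β ≤ 3, continuous on the boxes), `runs_exist` (BY
   NAME `FlowStep.couplingTrajectory_exists_history`: for every K a solution of (0.20) in ]0, 1/16] pinned at g_K = 1/16),
   `run`/`run_spec`, and `injectedRate_witness` = `T4BetaReadOutLipschitz.injectedRate_of_u3_on` applied BY NAME to the
   toy: `T4CauchySum.InjectedRate (1/8) 0 (1/2) (fun K j => disc (run K) (run (K+1)) j)` — node U2's output socket (node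
   U5's binder `hinj`, degree 0) INHABITED by data produced from U3-shaped inputs through the (R)-discharge of gen 7.
WHAT THIS SHOWS AND WHAT IT DOES NOT.  Shows: the liaison's binder list is consistent and not secretly degenerate (no
hidden quantifier/ordering/junk-value defect forces β to be scale-invariant, history-free or zero; the prepend–shift
re-indexing of `RepresentsB` is compatible with `RepresentsA`; the complex-chart encoding carries a non-constant analytic
family; the constants compose to a finite InjectedRate).  Does NOT show: anything about Bałaban's (2.13)/(2.14)
activities, NE5 or NE9 for them (cell NEW ESTIMATES, node U3 — GAPS G-t4-U3-1, G-t4-U3-3, G-ne9p2-3 / G-ne9p2-5), or the locality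
sum of the true (1.20)–(1.22) recipe (b03's chain, `T4BetaReadOutLipschitz` §4).  The wall of node U2 is unchanged:
(M) ≡ node U3's `ClusterGeom.PotentialKP` instance for the (2.14)-activities (record `t4/T4-EST-NE4-P1.md`).

CITATION HEADER (lean-in-tree rule 2026-08-18; v1.0.1 DOCFIX, XREAD C-pv03-72).  ONE passage of a source is quoted in this
module: the phrase *"it depends also on all preceding coupling constants"* in the docstring of `mem` (§1) is a
COPY of the verbatim quotation of [I] p. 298 (last paragraph, said there of β_j) certified in `T4BetaReadOutLipschitz`
l.40–41; nothing else is quoted, and the bracketed cite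
tags name the printed formulas whose SHAPE the toy objects caricature, all quoted verbatim in the certified headers of
`T4BetaReadOut` / `T4BetaReadOutLipschitz` (this lineage) and `T4OutputRate` (pv05): T. Bałaban, *Renormalization group
approach to lattice gauge field theories. I.*, Commun. Math. Phys. **109**, 249–301 (1987) [Balaban1987RG1] (cell paper
B12 = [I]; (0.20) p. 256, (1.18) p. 263, (1.20)–(1.22) p. 264, (4.3)–(4.4) p. 281, p. 298); T. Bałaban, *Convergent
renormalization expansions for lattice gauge theories*, Commun. Math. Phys. **119**, 243–285 (1988) [Balaban1988Convergent]
and *Large field renormalization. II*, Commun. Math. Phys. **122**, 355–392 (1989) [Balaban1989LargeFieldII] (framing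
only).  The Bałaban papers are manuscripts UNDER ADJUDICATION by the audit cell `pub-balaban`: NOTHING printed in them is
asserted here.  NEW module of unit `b2b-balaban-t4-ne4-p1-g8` (NE4 prover P1, gen 8; journal ONLINE + CLAIM
T4-U2.NE4-PROVE-P1g* l.52139); imports the tree module `T4BetaReadOutLipschitz` (this lineage, gen 7) and through it
`T4BetaReadOut`, `T4OutputRate`, `T4FlagMemory`, `T4CouplingMatching`, `T4CauchySum`, `FlowStep`, `B12Decay510` BY NAME,
and modifies nothing.
-/

namespace Literature.MathematicalPhysics.QuantumFieldTheory.Balaban1983to89.T4BetaReadOutWitness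

open Literature.MathematicalPhysics.QuantumFieldTheory.Balaban1983to89
open Literature.MathematicalPhysics.QuantumFieldTheory.Balaban1983to89.FlowStep
open Literature.MathematicalPhysics.QuantumFieldTheory.Balaban1983to89.T4OutputRate (Carriers Functional Window NE5 NE9
  DecayBound)
open Literature.MathematicalPhysics.QuantumFieldTheory.Balaban1983to89.T4BetaReadOut
open Literature.MathematicalPhysics.QuantumFieldTheory.Balaban1983to89.T4BetaReadOutLipschitz
open Literature.MathematicalPhysics.QuantumFieldTheory.Balaban1983to89.T4CouplingMatching (ScaleShiftRate HistLipschitz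
  EventualLowerH disc)
open Literature.MathematicalPhysics.QuantumFieldTheory.Balaban1983to89.T4FlagMemory (extd extd_coe extd_tail extd_adm)
open Literature.MathematicalPhysics.QuantumFieldTheory.Balaban1983to89.B12Decay510 (mixedDeriv)
open Metric Filter Topology
open scoped BigOperators

noncomputable section

/-! ## §1 The toy scheme -/

/-- THE TOY CARRIERS: domains `ℕ` (one domain per scale, created at step n, scale n + 1), tree length ≡ 0, both background
sorts `ℂ × Bool` (chart point, Re/Im tag — the encoding convention of `T4BetaReadOutLipschitz` §5), trivial gauge,
identity transport.  A caricature of the carrier data of (0.24)/(1.18); nothing of Bałaban's is modelled. [folklore] -/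
abbrev toyC : Carriers where
  Dom := ℕ
  scale := fun n => n + 1
  d := fun _ => 0
  d_nonneg := fun _ => le_rfl
  BgA := ℂ × Bool
  BgB := ℂ × Bool
  gauge := fun _ _ => 0
  gauge_nonneg := fun _ _ => le_rfl
  transport := fun U => U

/-- Scale of the toy domain `n` is `n + 1`. [folklore] -/
@[simp] theorem toyC_scale (n : ℕ) : toyC.scale n = n + 1 := rfl

/-- Tree length of every toy domain is `0`. [folklore] -/
@[simp] theorem toyC_d (n : ℕ) : toyC.d n = 0 := rfl

/-- The toy transport is the identity. [folklore] -/
@[simp] theorem toyC_transport (U : ℂ × Bool) : toyC.transport U = U := rfl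

/-- THE FADING-MEMORY ACCUMULATOR of a coupling sequence: `mem ω g 0 = 0`, `mem ω g (s+1) = ω (mem ω g s + g s)` — the
discrete fading-memory recursion (each step contracts the accumulated past by ω and adds the newest coupling), the model
of *"it depends also on all preceding coupling constants"* ([I] p. 298, last paragraph, said of β_j — a COPY of the span
quoted verbatim and certified in `T4BetaReadOutLipschitz` l.40–41; structure only). [cite: Balaban1987RG1, §5 p.298] -/
def mem (ω : ℝ) (g : ℕ → ℝ) : ℕ → ℝ
  | 0 => 0
  | s + 1 => ω * (mem ω g s + g s)

/-- Unfolding at `0`. [folklore] -/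
@[simp] theorem mem_zero (ω : ℝ) (g : ℕ → ℝ) : mem ω g 0 = 0 := rfl

/-- Unfolding at a successor. [folklore] -/
@[simp] theorem mem_succ (ω : ℝ) (g : ℕ → ℝ) (s : ℕ) : mem ω g (s + 1) = ω * (mem ω g s + g s) := rfl

/-- CLOSED FORM: `mem ω g s = Σ_{i<s} ω^{s−i} g_i` — every preceding coupling enters, with geometric weight in its age.
[folklore] -/
theorem mem_eq_sum (ω : ℝ) (g : ℕ → ℝ) (s : ℕ) : mem ω g s = ∑ i ∈ Finset.range s, ω ^ (s - i) * g i := by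
  induction s with
  | zero => simp
  | succ s ih =>
    rw [mem_succ, ih, Finset.sum_range_succ, mul_add, Finset.mul_sum, Nat.add_sub_cancel_left, pow_one]
    congr 1
    refine Finset.sum_congr rfl fun i hi => ?_
    rw [Finset.mem_range] at hi
    rw [show s + 1 - i = (s - i) + 1 by omega, pow_succ']
    ring

/-- PREPENDING a coupling: `prepend b g = (b, g_0, g_1, …)`. [folklore] -/
def prepend (b : ℝ) (g : ℕ → ℝ) : ℕ → ℝ
  | 0 => b
  | m + 1 => g m

/-- Unfolding at `0`. [folklore] -/
@[simp] theorem prepend_zero (b : ℝ) (g : ℕ → ℝ) : prepend b g 0 = b := rfl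

/-- Unfolding at a successor. [folklore] -/
@[simp] theorem prepend_succ (b : ℝ) (g : ℕ → ℝ) (m : ℕ) : prepend b g (m + 1) = g m := rfl

/-- INDEX BOOKKEEPING (`T4FlagMemory.extd_tail`): the extension of a history `w = (w_0, …, w_{k+1})` is its finest entry
prepended to the extension of `Fin.tail w`. [folklore] -/
theorem prepend_extd_tail {k : ℕ} (w : Fin (k + 2) → ℝ) : prepend (w 0) (extd (Fin.tail w)) = extd w := by
  funext m
  cases m with
  | zero => simp [prepend, extd]
  | succ m => rw [prepend_succ, extd_tail]

/-- THE PREPEND–SHIFT IDENTITY: prepending `b` and reading one scale up adds exactly `ω^{s+1} b` to the accumulator.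
[folklore] -/
theorem mem_prepend (ω b : ℝ) (g : ℕ → ℝ) (s : ℕ) : mem ω (prepend b g) (s + 1) = ω ^ (s + 1) * b + mem ω g s := by
  induction s with
  | zero => simp
  | succ s ih =>
    rw [mem_succ, ih, prepend_succ, mem_succ, pow_succ]
    ring

/-- HISTORY LIPSCHITZ BOUND of the accumulator: `∣mem ω g s − mem ω g' s∣ ≤ Σ_{i<s} ω^{s−i}∣g_i − g'_i∣` (ω ≥ 0), by the
recursion. [folklore] -/
theorem abs_mem_sub_le {ω : ℝ} (hω : 0 ≤ ω) (g g' : ℕ → ℝ) (s : ℕ) :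
    |mem ω g s - mem ω g' s| ≤ ∑ i ∈ Finset.range s, ω ^ (s - i) * |g i - g' i| := by
  induction s with
  | zero => simp
  | succ s ih =>
    rw [mem_succ, mem_succ, ← mul_sub, abs_mul, abs_of_nonneg hω, Finset.sum_range_succ, Nat.add_sub_cancel_left,
      pow_one]
    have hsplit : mem ω g s + g s - (mem ω g' s + g' s) = (mem ω g s - mem ω g' s) + (g s - g' s) := by ring
    rw [hsplit]
    have hre : ∑ i ∈ Finset.range s, ω ^ (s + 1 - i) * |g i - g' i|
        = ω * ∑ i ∈ Finset.range s, ω ^ (s - i) * |g i - g' i| := by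
      rw [Finset.mul_sum]
      refine Finset.sum_congr rfl fun i hi => ?_
      rw [Finset.mem_range] at hi
      rw [show s + 1 - i = (s - i) + 1 by omega, pow_succ']
      ring
    rw [hre]
    calc ω * |mem ω g s - mem ω g' s + (g s - g' s)|
        ≤ ω * (|mem ω g s - mem ω g' s| + |g s - g' s|) := mul_le_mul_of_nonneg_left (abs_add_le _ _) hω
      _ ≤ ω * (∑ i ∈ Finset.range s, ω ^ (s - i) * |g i - g' i| + |g s - g' s|) := by gcongr
      _ = ω * ∑ i ∈ Finset.range s, ω ^ (s - i) * |g i - g' i| + ω * |g s - g' s| := mul_add _ _ _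

/-- The accumulator of a nonnegative sequence is nonnegative (ω ≥ 0). [folklore] -/
theorem mem_nonneg {ω : ℝ} (hω : 0 ≤ ω) {g : ℕ → ℝ} (hg : ∀ i, 0 ≤ g i) (s : ℕ) : 0 ≤ mem ω g s := by
  induction s with
  | zero => simp
  | succ s ih => rw [mem_succ]; exact mul_nonneg hω (add_nonneg ih (hg s))

/-- DISCRETE GRÖNWALL for the accumulator: on the window `g ≤ γ`, `mem ω g s ≤ ωγ/(1−ω)` for every s (0 ≤ ω < 1), by
induction through the recursion. [folklore] -/
theorem mem_le {ω γ : ℝ} (hω0 : 0 ≤ ω) (hω1 : ω < 1) (hγ : 0 ≤ γ) {g : ℕ → ℝ} (hg : ∀ i, g i ≤ γ) (s : ℕ) :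
    mem ω g s ≤ ω * γ / (1 - ω) := by
  have h1 : 0 < 1 - ω := sub_pos.mpr hω1
  induction s with
  | zero => rw [mem_zero]; positivity
  | succ s ih =>
    rw [mem_succ]
    calc ω * (mem ω g s + g s) ≤ ω * (ω * γ / (1 - ω) + γ) := by gcongr; exact hg s
      _ = ω * γ / (1 - ω) := by field_simp; ring

/-- THE CUT-OFF SQUARE: `A²` on the open unit chart ball, `0` outside — analytic exactly on the ball ((4.4)-type domain),
bounded by 1 on ALL backgrounds of the carrier. [cite: Balaban1987RG1, (4.4) p.281] -/
def cutSq (A : ℂ) : ℂ := if ‖A‖ < 1 then A ^ 2 else 0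

/-- `‖cutSq A‖ ≤ 1` everywhere. [folklore] -/
theorem norm_cutSq_le (A : ℂ) : ‖cutSq A‖ ≤ 1 := by
  unfold cutSq
  split_ifs with h
  · rw [norm_pow]
    nlinarith [norm_nonneg A]
  · simp

/-- On the open unit ball the scaled cut-off square IS the polynomial `m·A²`, locally. [folklore] -/
theorem mul_cutSq_eventuallyEq (m : ℂ) {A : ℂ} (hA : ‖A‖ < 1) :
    (fun z : ℂ => m * cutSq z) =ᶠ[𝓝 A] fun z : ℂ => m * z ^ 2 := by
  have hball : ball (0 : ℂ) 1 ∈ 𝓝 A := isOpen_ball.mem_nhds (mem_ball_zero_iff.mpr hA)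
  filter_upwards [hball] with z hz
  rw [mem_ball_zero_iff] at hz
  simp [cutSq, hz]

/-- The scaled cut-off square is analytic on the open unit ball. [folklore] -/
theorem analyticOnNhd_mul_cutSq (m : ℂ) : AnalyticOnNhd ℂ (fun z : ℂ => m * cutSq z) (ball 0 1) := by
  intro A hA
  rw [mem_ball_zero_iff] at hA
  have h : AnalyticAt ℂ (fun z : ℂ => m * z ^ 2) A := analyticAt_const.mul ((analyticAt_id).pow 2)
  exact h.congr (mul_cutSq_eventuallyEq m hA).symm

/-- **The (4.3)-type mixed derivative of the toy activity (kernel, Mathlib calculus):**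
`B12Decay510.mixedDeriv (m · cutSq) 1 1 = 2m` — ∂²/∂τ₁∂τ₂ [m(τ₁ + τ₂)²]∣₀ = 2m. [cite: Balaban1987RG1, (4.3) p.281] -/
theorem mixedDeriv_mul_cutSq (m : ℂ) : mixedDeriv (fun z : ℂ => m * cutSq z) 1 1 = 2 * m := by
  unfold mixedDeriv
  have h0 : ∀ᶠ τ : ℂ in 𝓝 0, ‖τ‖ < 1 := by
    have : ball (0 : ℂ) 1 ∈ 𝓝 (0 : ℂ) := isOpen_ball.mem_nhds (mem_ball_self one_pos)
    filter_upwards [this] with τ hτ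
    exact mem_ball_zero_iff.mp hτ
  have h1 : (fun τ : ℂ => (fderiv ℂ (fun z : ℂ => m * cutSq z) (τ • (1 : ℂ))) 1) =ᶠ[𝓝 0]
      fun τ : ℂ => m * (2 * τ) := by
    filter_upwards [h0] with τ hτ
    rw [smul_eq_mul, mul_one, fderiv_eq_smul_deriv, one_smul, (mul_cutSq_eventuallyEq m hτ).deriv_eq]
    have hd : HasDerivAt (fun z : ℂ => m * z ^ 2) (m * (2 * τ)) τ := by
      have := (hasDerivAt_pow 2 τ).const_mul m
      simpa using this
    exact hd.deriv
  rw [h1.deriv_eq]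
  have h2 : HasDerivAt (fun τ : ℂ => m * (2 * τ)) (m * (2 * 1)) 0 :=
    ((hasDerivAt_id' (0 : ℂ)).const_mul 2).const_mul m
  rw [h2.deriv]
  ring

/-- THE TOY ACTIVITIES: `act ω c₀ g X A = (c₀ + mem ω g (X+1)) · cutSq A` — the scale-(X+1) term at couplings g and
chart background A: a constant plus the fading-memory accumulator of the preceding couplings, times an analytic function
of the background.  A caricature of the TYPE of (1.18)/(4.4) terms; nothing of (2.13) is modelled.
[cite: Balaban1987RG1, (1.18) p.263] -/
def act (ω c₀ : ℝ) (g : ℕ → ℝ) : ℕ → ℂ → ℂ := fun X A => (((c₀ + mem ω g (X + 1) : ℝ)) : ℂ) * cutSq A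

/-- The toy activity is analytic on the unit chart ball. [folklore] -/
theorem analyticOnNhd_act (ω c₀ : ℝ) (g : ℕ → ℝ) (X : ℕ) : AnalyticOnNhd ℂ (act ω c₀ g X) (ball 0 1) :=
  analyticOnNhd_mul_cutSq _

/-- The (4.3)-type mixed derivative of the toy activity along (1, 1): `2(c₀ + mem ω g (X+1))`. [folklore] -/
theorem mixedDeriv_act (ω c₀ : ℝ) (g : ℕ → ℝ) (X : ℕ) :
    mixedDeriv (act ω c₀ g X) 1 1 = ((2 * (c₀ + mem ω g (X + 1)) : ℝ) : ℂ) := by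
  rw [show act ω c₀ g X = fun z : ℂ => (((c₀ + mem ω g (X + 1) : ℝ)) : ℂ) * cutSq z from rfl, mixedDeriv_mul_cutSq]
  push_cast
  ring

/-- RUN A's FUNCTIONAL: the tagged slice of the toy activities (Re at tag `true`, Im at tag `false` — the encoding
convention `T4BetaReadOutLipschitz.tagSlice`). [folklore] -/
def EA (ω c₀ : ℝ) : Functional toyC toyC.BgA := fun g U X => tagSlice (C := toyC) (act ω c₀ g) U X

/-- RUN B's FUNCTIONAL by the PREPEND–SHIFT CONVENTION: run B (one extra finest scale, coupling `b` there) at re-indexed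
couplings g, read on domain X, is run A at couplings `prepend b g` read on domain X + 1 (the re-indexing behind
`T4BetaReadOut.RepresentsB`). [cite: Balaban1987RG1, (1.20)-(1.22) p.264] -/
def EB (ω c₀ : ℝ) : ℝ → Functional toyC toyC.BgB := fun b g U (X : ℕ) => EA ω c₀ (prepend b g) U (X + 1)

/-- ONE PROBE PER STEP: at step k the domain k (scale k + 1), both directions `1 ∈ ℂ`, weight `wt`, tagged charts
(`T4BetaReadOutLipschitz.tagged`). [cite: Balaban1987RG1, (1.20)-(1.22) p.264] -/
def toyP (wt : ℝ) : Probes toyC (ℂ × Bool) ℂ Unit :=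
  tagged (C := toyC) (fun _ => Finset.univ) (fun k _ => k) (fun _ _ _ => rfl) (fun _ _ => 1) (fun _ _ => 1)
    (fun _ _ => wt)

/-- The history moduli of the toy: `Λω ω s i = ω^{s−i}`. [folklore] -/
def Λω (ω : ℝ) : ℕ → ℕ → ℝ := fun s i => ω ^ (s - i)

/-- THE TOY β-FAMILY, READ OFF run A by the transported probe recipe at the extended history (so that
`T4BetaReadOut.RepresentsA` holds by definition). [cite: Balaban1987RG1, (1.20)-(1.22) p.264] -/
def toyβ (ω c₀ wt : ℝ) : HBeta := fun k v => (toyP wt).transportTo.recipe k (EA ω c₀ (extd v))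

/-! ## §2 Kernel facts about the toy: chart functions, recipe in closed form -/

/-- A tagged slice difference at one tagged background is bounded by the norm of the complex difference. [folklore] -/
theorem abs_tagSlice_sub_le (E E' : ℕ → ℂ → ℂ) (A : ℂ) (t : Bool) (X X' : ℕ) :
    |tagSlice (C := toyC) E (A, t) X - tagSlice (C := toyC) E' (A, t) X'| ≤ ‖E X A - E' X' A‖ := by
  cases t
  · simp only [tagSlice, Bool.false_eq_true, if_false]
    rw [← Complex.sub_im]
    exact Complex.abs_im_le_norm _
  · simp only [tagSlice, if_true]
    rw [← Complex.sub_re]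
    exact Complex.abs_re_le_norm _

/-- A tagged slice value is bounded by the norm of the complex value. [folklore] -/
theorem abs_tagSlice_le (E : ℕ → ℂ → ℂ) (A : ℂ) (t : Bool) (X : ℕ) :
    |tagSlice (C := toyC) E (A, t) X| ≤ ‖E X A‖ := by
  cases t
  · simp only [tagSlice, Bool.false_eq_true, if_false]
    exact Complex.abs_im_le_norm _
  · simp only [tagSlice, if_true]
    exact Complex.abs_re_le_norm _

/-- Run A's rebuilt chart function (through the identity transport) IS the toy activity (`Probes.cplx_of_encodes`).
[folklore] -/
theorem transportTo_cplx_EA (ω c₀ wt : ℝ) (g : ℕ → ℝ) (k : ℕ) (p : Unit) :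
    (toyP wt).transportTo.cplx (EA ω c₀ g) k p = act ω c₀ g k :=
  (toyP wt).transportTo.cplx_of_encodes (fun _ => rfl) (fun _ => rfl)

/-- Run B's rebuilt chart function IS the toy activity at the prepended couplings, one scale up. [folklore] -/
theorem cplx_EB (ω c₀ wt b : ℝ) (g : ℕ → ℝ) (k : ℕ) (p : Unit) :
    (toyP wt).cplx (EB ω c₀ b g) k p = act ω c₀ (prepend b g) (k + 1) :=
  (toyP wt).cplx_of_encodes (fun _ => rfl) (fun _ => rfl)

/-- RUN A's RECIPE IN CLOSED FORM: `(toyP wt).transportTo.recipe k (EA ω c₀ g) = 2wt(c₀ + mem ω g (k+1))`. [folklore] -/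
theorem recipeA_apply (ω c₀ wt : ℝ) (g : ℕ → ℝ) (k : ℕ) :
    (toyP wt).transportTo.recipe k (EA ω c₀ g) = 2 * wt * (c₀ + mem ω g (k + 1)) := by
  have h1 : (toyP wt).transportTo.recipe k (EA ω c₀ g) =
      ∑ p : Unit, wt * (mixedDeriv ((toyP wt).transportTo.cplx (EA ω c₀ g) k p) (1 : ℂ) 1).re := rfl
  rw [h1, Fintype.sum_unique, transportTo_cplx_EA, mixedDeriv_act, Complex.ofReal_re]
  ring

/-- RUN B's RECIPE IN CLOSED FORM: `(toyP wt).recipe k (EB ω c₀ b g) = 2wt(c₀ + mem ω (prepend b g) (k+2))`. [folklore] -/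
theorem recipeB_apply (ω c₀ wt b : ℝ) (g : ℕ → ℝ) (k : ℕ) :
    (toyP wt).recipe k (EB ω c₀ b g) = 2 * wt * (c₀ + mem ω (prepend b g) (k + 2)) := by
  have h1 : (toyP wt).recipe k (EB ω c₀ b g) =
      ∑ p : Unit, wt * (mixedDeriv ((toyP wt).cplx (EB ω c₀ b g) k p) (1 : ℂ) 1).re := rfl
  rw [h1, Fintype.sum_unique, cplx_EB, mixedDeriv_act, Complex.ofReal_re]
  ring

/-- THE TOY β IN CLOSED FORM: `toyβ ω c₀ wt k v = 2wt(c₀ + mem ω (extd v) (k+1))`. [folklore] -/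
theorem toyβ_apply (ω c₀ wt : ℝ) (k : ℕ) (v : Fin (k + 1) → ℝ) :
    toyβ ω c₀ wt k v = 2 * wt * (c₀ + mem ω (extd v) (k + 1)) :=
  recipeA_apply ω c₀ wt (extd v) k

/-- The accumulator of an extended history is the geometrically weighted sum of ALL its entries:
`mem ω (extd v) (k+1) = Σ_{i ≤ k} ω^{k+1−i} v_i`. [folklore] -/
theorem mem_extd (ω : ℝ) {k : ℕ} (v : Fin (k + 1) → ℝ) :
    mem ω (extd v) (k + 1) = ∑ i : Fin (k + 1), ω ^ (k + 1 - (i : ℕ)) * v i := by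
  rw [mem_eq_sum, Finset.sum_range]
  refine Finset.sum_congr rfl fun i _ => ?_
  rw [extd_coe]

/-- HISTORY DEPENDENCE WITH FADING MEMORY, explicitly: `β_{k+1}(v_0, …, v_k) = 2wt(c₀ + Σ_{i≤k} ω^{k+1−i} v_i)` — every
coupling of the history enters, weighted geometrically in its age. [cite: Balaban1987RG1, §5 p.298] -/
theorem toyβ_eq_sum (ω c₀ wt : ℝ) (k : ℕ) (v : Fin (k + 1) → ℝ) :
    toyβ ω c₀ wt k v = 2 * wt * (c₀ + ∑ i : Fin (k + 1), ω ^ (k + 1 - (i : ℕ)) * v i) := by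
  rw [toyβ_apply, mem_extd]

/-! ## §3 Every binder of `Probes.ne4_of_u3_recipe` holds on the toy -/

/-- WINDOW: extended box histories lie in the window (`T4BetaReadOut.extd_mem_window`). [folklore] -/
theorem window_toy (γ : ℝ) : ∀ k (v : Fin (k + 1) → ℝ), v ∈ Box γ k → extd v ∈ Window γ :=
  fun _ _ hv => extd_mem_window hv

/-- **NE5 ON THE TOY, every datum (kernel):** for `b ∈ ]0, γ]`, `NE5 (EA ω c₀) (EB ω c₀ b) (Window γ) κ ω (γω)` — the
two runs' terms at the same couplings and background differ by `ω^{X+2}·b·cutSq`, i.e. by at most `γω · ω^{scale X}`: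
the prepend–shift identity `mem_prepend`. [folklore] -/
theorem ne5_toy {ω : ℝ} (hω : 0 ≤ ω) (c₀ γ κ : ℝ) :
    ∀ b, 0 < b → b ≤ γ → NE5 (EA ω c₀) (EB ω c₀ b) (Window γ) κ ω (γ * ω) := by
  intro b hb hbγ g _ U X
  obtain ⟨A, t⟩ := U
  simp only [mul_zero, neg_zero, Real.exp_zero, mul_one]
  show |tagSlice (C := toyC) (act ω c₀ g) (A, t) X - tagSlice (C := toyC) (act ω c₀ (prepend b g)) (A, t) (X + 1)|
    ≤ γ * ω * ω ^ (X + 1)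
  refine (abs_tagSlice_sub_le _ _ A t X (X + 1)).trans ?_
  have hdiff : act ω c₀ g X A - act ω c₀ (prepend b g) (X + 1) A = -(((ω ^ (X + 2) * b : ℝ)) : ℂ) * cutSq A := by
    simp only [act]
    rw [show X + 1 + 1 = (X + 1) + 1 from rfl, mem_prepend]
    push_cast
    ring
  rw [hdiff, norm_mul, norm_neg, Complex.norm_real, Real.norm_eq_abs,
    abs_of_nonneg (mul_nonneg (pow_nonneg hω _) hb.le)]
  have hωX : 0 ≤ ω ^ (X + 2) := pow_nonneg hω _
  calc ω ^ (X + 2) * b * ‖cutSq A‖ ≤ ω ^ (X + 2) * γ * 1 :=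
        mul_le_mul (mul_le_mul_of_nonneg_left hbγ hωX) (norm_cutSq_le A) (norm_nonneg _)
          (mul_nonneg hωX (hb.le.trans hbγ))
    _ = γ * ω * ω ^ (X + 1) := by ring

/-- **NE9 ON THE TOY (kernel):** `NE9 (EA ω c₀) (Window γ) κ (Λω ω)` — joint Lipschitz dependence on the preceding
couplings with moduli `ω^{scale X − i}`: `abs_mem_sub_le`. [folklore] -/
theorem ne9_toy {ω : ℝ} (hω : 0 ≤ ω) (c₀ γ κ : ℝ) : NE9 (EA ω c₀) (Window γ) κ (Λω ω) := by
  intro g _ g' _ U X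
  obtain ⟨A, t⟩ := U
  simp only [mul_zero, neg_zero, Real.exp_zero, one_mul, Λω]
  show |tagSlice (C := toyC) (act ω c₀ g) (A, t) X - tagSlice (C := toyC) (act ω c₀ g') (A, t) X|
    ≤ ∑ i ∈ Finset.range (X + 1), ω ^ (X + 1 - i) * |g i - g' i|
  refine (abs_tagSlice_sub_le _ _ A t X X).trans ?_
  have hdiff : act ω c₀ g X A - act ω c₀ g' X A = (((mem ω g (X + 1) - mem ω g' (X + 1) : ℝ)) : ℂ) * cutSq A := by
    simp only [act]
    push_cast
    ring
  rw [hdiff, norm_mul, Complex.norm_real, Real.norm_eq_abs]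
  calc |mem ω g (X + 1) - mem ω g' (X + 1)| * ‖cutSq A‖
      ≤ (∑ i ∈ Finset.range (X + 1), ω ^ (X + 1 - i) * |g i - g' i|) * 1 :=
        mul_le_mul (abs_mem_sub_le hω g g' (X + 1)) (norm_cutSq_le A) (norm_nonneg _)
          (Finset.sum_nonneg fun i _ => mul_nonneg (pow_nonneg hω _) (abs_nonneg _))
    _ = ∑ i ∈ Finset.range (X + 1), ω ^ (X + 1 - i) * |g i - g' i| := mul_one _

/-- **FADING MEMORY OF THE TOY MODULI (kernel):** `T4OutputRate.FadingMemory 1 ω (Λω ω)`. [folklore] -/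
theorem fadingMemory_toy {ω : ℝ} (hω : 0 ≤ ω) : T4OutputRate.FadingMemory 1 ω (Λω ω) :=
  fun k i _ => ⟨pow_nonneg hω _, by rw [Λω, one_mul]⟩

/-- **RepresentsA ON THE TOY** — by definition of `toyβ`. [folklore] -/
theorem representsA_toy (ω c₀ wt γ : ℝ) : RepresentsA (EA ω c₀) (toyP wt).transportTo.recipe γ (toyβ ω c₀ wt) :=
  fun _ _ _ => rfl

/-- **RepresentsB ON THE TOY (kernel):** the prepend–shift convention is compatible with RepresentsA — run B's recipe at
step k on `EB (w 0) (extd (Fin.tail w))` equals run A's at step k + 1 on `EA (extd w)`, by `prepend_extd_tail`.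
[cite: Balaban1987RG1, (1.20)-(1.22) p.264] -/
theorem representsB_toy (ω c₀ wt γ : ℝ) : RepresentsB (EB ω c₀) (toyP wt).recipe γ (toyβ ω c₀ wt) := by
  intro k w _
  rw [toyβ_apply, recipeB_apply, prepend_extd_tail]

/-- **ANALYTICITY, run A (kernel):** every run-A slice of the toy lies in the transported admissible class on the unit
ball. [folklore] -/
theorem analyticA_toy (ω c₀ wt γ : ℝ) : ∀ g ∈ Window γ, EA ω c₀ g ∈ (toyP wt).transportTo.Analytic 1 := by
  intro g _ k p _
  rw [transportTo_cplx_EA]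
  exact analyticOnNhd_act ω c₀ g k

/-- **ANALYTICITY, run B, every datum (kernel).** [folklore] -/
theorem analyticB_toy (ω c₀ wt γ : ℝ) :
    ∀ b, 0 < b → b ≤ γ → ∀ g ∈ Window γ, EB ω c₀ b g ∈ (toyP wt).Analytic 1 := by
  intro b _ _ g _ k p _
  rw [cplx_EB]
  exact analyticOnNhd_act ω c₀ (prepend b g) (k + 1)

/-- **LOCALITY SUM OF THE TOY PROBES (kernel):** `(toyP wt).LocalitySum κ ∣wt∣` (one probe, unit directions, d ≡ 0).
[folklore] -/
theorem localitySum_toy (wt κ : ℝ) : (toyP wt).LocalitySum κ |wt| := by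
  intro k
  show ∑ p ∈ (Finset.univ : Finset Unit), |wt| * ‖(1 : ℂ)‖ * ‖(1 : ℂ)‖ * Real.exp (-(κ * 0)) ≤ |wt|
  simp

/-- Every step reads one probe. [folklore] -/
theorem idx_nonempty (wt : ℝ) : ∀ k, ((toyP wt).idx k).Nonempty := fun _ => Finset.univ_nonempty

/-- BONUS — the printed-form binder (1.18) also holds on the toy: `DecayBound (EA ω c₀) (Window γ) (c₀ + ωγ/(1−ω)) κ`
for `0 ≤ ω < 1`, `0 ≤ c₀`, `0 ≤ γ` (`mem_le`). [cite: Balaban1987RG1, (1.18) p.263] -/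
theorem decayBound_toy {ω c₀ γ : ℝ} (hω0 : 0 ≤ ω) (hω1 : ω < 1) (hc₀ : 0 ≤ c₀) (hγ : 0 ≤ γ) (κ : ℝ) :
    DecayBound (EA ω c₀) (Window γ) (c₀ + ω * γ / (1 - ω)) κ := by
  intro g hg U X
  obtain ⟨A, t⟩ := U
  simp only [mul_zero, neg_zero, Real.exp_zero, mul_one]
  show |tagSlice (C := toyC) (act ω c₀ g) (A, t) X| ≤ c₀ + ω * γ / (1 - ω)
  refine (abs_tagSlice_le _ A t X).trans ?_
  have hm0 : 0 ≤ c₀ + mem ω g (X + 1) := add_nonneg hc₀ (mem_nonneg hω0 (fun i => (hg i).1.le) _)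
  simp only [act]
  rw [norm_mul, Complex.norm_real, Real.norm_eq_abs, abs_of_nonneg hm0]
  have hle : c₀ + mem ω g (X + 1) ≤ c₀ + ω * γ / (1 - ω) := by
    have := mem_le hω0 hω1 hγ (fun i => (hg i).2) (X + 1)
    linarith
  calc (c₀ + mem ω g (X + 1)) * ‖cutSq A‖ ≤ (c₀ + ω * γ / (1 - ω)) * 1 :=
        mul_le_mul hle (norm_cutSq_le A) (norm_nonneg _) (hm0.trans hle)
    _ = c₀ + ω * γ / (1 - ω) := mul_one _

/-- **NODE U2's TRIPLE ON THE TOY, BY NAME (kernel):** `T4BetaReadOutLipschitz.Probes.ne4_of_u3_recipe` applied to the toy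
scheme — every one of its eleven hypotheses discharged by §3 — gives NE4 (scale-shift rate), the history moduli and their
fading memory for `toyβ`, with the gen-7 read-out constant `cr = 8∣wt∣/1²`.  A witness that the binder list of the
DEPENDENT booking of NE4 is jointly satisfiable; nothing about Bałaban's activities.
[cite: Balaban1987RG1, (1.20)-(1.22) p.264] -/
theorem u2_triple_toy {ω : ℝ} (hω : 0 ≤ ω) (c₀ wt γ κ : ℝ) :
    ScaleShiftRate (8 * |wt| / 1 ^ 2 * (γ * ω) * ω) ω γ (toyβ ω c₀ wt) ∧
      HistLipschitz (fun k i => 8 * |wt| / 1 ^ 2 * Λω ω (k + 1) i) γ (toyβ ω c₀ wt) ∧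
        T4CouplingMatching.FadingMemory (8 * |wt| / 1 ^ 2 * 1 * ω) ω (fun k i => 8 * |wt| / 1 ^ 2 * Λω ω (k + 1) i) :=
  (toyP wt).ne4_of_u3_recipe (window_toy γ) (ne5_toy hω c₀ γ κ) (ne9_toy hω c₀ γ κ) (fadingMemory_toy hω)
    (representsA_toy ω c₀ wt γ) (representsB_toy ω c₀ wt γ) (analyticA_toy ω c₀ wt γ) (analyticB_toy ω c₀ wt γ)
    one_pos (localitySum_toy wt κ) (idx_nonempty wt)

/-! ## §4 Non-degeneracy, and the end-to-end InjectedRate at explicit numbers -/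

/-- THE WITNESS β: ω = 1/4, c₀ = 1, wt = 1. [folklore] -/
def βw : HBeta := toyβ (1 / 4) 1 1

/-- Closed form of the witness β: `βw k v = 2(1 + Σ_{i≤k} (1/4)^{k+1−i} v_i)`. [folklore] -/
theorem βw_apply (k : ℕ) (v : Fin (k + 1) → ℝ) :
    βw k v = 2 * (1 + ∑ i : Fin (k + 1), (1 / 4 : ℝ) ^ (k + 1 - (i : ℕ)) * v i) := by
  rw [βw, toyβ_eq_sum]
  ring

/-- **THE SCALE SHIFT IS EXACT AND NONZERO (kernel):** `βw (k+1) w − βw k (Fin.tail w) = 2·(1/4)^{k+2}·w_0` — NE4's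
content (`T4CouplingMatching.ScaleShiftRate`) is genuine on the toy, at rate exactly ω^k. [folklore] -/
theorem βw_scaleShift (k : ℕ) (w : Fin (k + 2) → ℝ) :
    βw (k + 1) w - βw k (Fin.tail w) = 2 * (1 / 4 : ℝ) ^ (k + 2) * w 0 := by
  have h := mem_prepend (1 / 4 : ℝ) (w 0) (extd (Fin.tail w)) (k + 1)
  rw [prepend_extd_tail] at h
  rw [βw, toyβ_apply, toyβ_apply, h]
  ring

/-- On the box the scale shift is STRICTLY POSITIVE (so no constant-zero reading of NE4 is possible on the toy). [folklore] -/
theorem βw_scaleShift_pos (k : ℕ) {γ : ℝ} {w : Fin (k + 2) → ℝ} (hw : w ∈ Box γ (k + 1)) :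
    0 < βw (k + 1) w - βw k (Fin.tail w) := by
  rw [βw_scaleShift]
  have := (mem_box.mp hw 0).1
  positivity

/-- **NOT LAST-ONLY (kernel):** `βw 1` depends on the OLDEST coupling — `βw 1 (x, y) − βw 1 (x', y) = 2·(1/4)²·(x − x')`.
[cite: Balaban1987RG1, §5 p.298] -/
theorem βw_oldest (x x' y : ℝ) : βw 1 ![x, y] - βw 1 ![x', y] = 2 * (1 / 4 : ℝ) ^ 2 * (x - x') := by
  rw [βw_apply, βw_apply, Fin.sum_univ_two, Fin.sum_univ_two]
  simp
  ring

/-- **THE TWO RUNS GENUINELY DIFFER (kernel):** NE5 FAILS on the toy with constant `C₅ = 0` (datum b = 1/16) — the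
η-shift of the toy terms is not zero, so `ne5_toy`'s `C₅ = γω` is not an artefact of a degenerate pairing. [folklore] -/
theorem ne5_toy_not_zero : ¬ NE5 (EA (1 / 4) 1) (EB (1 / 4) 1 (1 / 16)) (Window (1 / 16)) 0 (1 / 4) 0 := by
  intro h
  have hg : (fun _ : ℕ => (1 / 16 : ℝ)) ∈ Window (1 / 16) := fun _ => ⟨by norm_num, le_rfl⟩
  have h1 := h _ hg ((1 / 2 : ℂ), true) 0
  simp only [zero_mul] at h1
  have h2 : EA (1 / 4) 1 (fun _ : ℕ => (1 / 16 : ℝ)) ((1 / 2 : ℂ), true) 0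
      - EB (1 / 4) 1 (1 / 16) (fun _ : ℕ => (1 / 16 : ℝ)) ((1 / 2 : ℂ), true) 0 = -(1 / 4) ^ 2 * (1 / 16) * (1 / 4) := by
    show tagSlice (C := toyC) (act (1 / 4) 1 fun _ : ℕ => (1 / 16 : ℝ)) ((1 / 2 : ℂ), true) 0
      - tagSlice (C := toyC) (act (1 / 4) 1 (prepend (1 / 16) fun _ : ℕ => (1 / 16 : ℝ))) ((1 / 2 : ℂ), true) (0 + 1) = _
    have hc : cutSq (1 / 2 : ℂ) = 1 / 4 := by
      have : ‖(1 / 2 : ℂ)‖ < 1 := by norm_num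
      rw [cutSq, if_pos this]
      norm_num
    simp only [tagSlice, if_true, act, hc, zero_add, mem_succ, mem_zero, prepend_zero]
    norm_num
  rw [h2] at h1
  norm_num at h1

/-- LOWER BOUND of the witness β on the boxes: `2 ≤ βw k v` (discrete asymptotic freedom of the toy, b = 2). [folklore] -/
theorem βw_lower : ∀ k (v : Fin (k + 1) → ℝ), v ∈ Box (1 / 16) k → 2 ≤ βw k v := by
  intro k v hv
  rw [βw, toyβ_apply]
  have := mem_nonneg (ω := 1 / 4) (by norm_num) (fun i => ((extd_adm hv) i).1.le) (k + 1)
  linarith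

/-- UPPER BOUND of the witness β on the boxes: `βw k v ≤ 3` (`mem_le`: 2(1 + (1/4)(1/16)/(3/4)) = 2 + 1/24 ≤ 3).
[folklore] -/
theorem βw_upper : ∀ k (v : Fin (k + 1) → ℝ), v ∈ Box (1 / 16) k → βw k v ≤ 3 := by
  intro k v hv
  rw [βw, toyβ_apply]
  have := mem_le (ω := 1 / 4) (γ := 1 / 16) (by norm_num) (by norm_num) (by norm_num)
    (fun i => ((extd_adm hv) i).2) (k + 1)
  norm_num at this ⊢
  linarith

/-- CONTINUITY of the witness β on the boxes (a polynomial in the history). [folklore] -/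
theorem βw_cont : BetaContH (1 / 16) βw := by
  intro k
  have h : βw k = fun v => 2 * (1 + ∑ i : Fin (k + 1), (1 / 4 : ℝ) ^ (k + 1 - (i : ℕ)) * v i) :=
    funext (βw_apply k)
  rw [h]
  exact (continuous_const.mul (continuous_const.add
    (continuous_finsetSum _ fun i _ => continuous_const.mul (continuous_apply i)))).continuousOn

/-- **RUNS EXIST (kernel, BY NAME `FlowStep.couplingTrajectory_exists_history`):** for every K and every pinned value
`g ∈ ]0, 1/16]` a solution of (0.20) for `βw` inside ]0, 1/16] with `g_K = g`. [cite: Balaban1987RG1, (0.20) p.256] -/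
theorem runs_exist : ∀ (K : ℕ) (g : ℝ), 0 < g → g ≤ 1 / 16 →
    ∃ gs : ℕ → ℝ, gs K = g ∧ RGEqH K βw gs ∧ (∀ k, k ≤ K → 0 < gs k ∧ gs k ≤ 1 / 16) ∧
      ∀ k, k ≤ K → 1 / g ^ 2 + 2 * ((K : ℝ) - k) ≤ 1 / (gs k) ^ 2 ∧ 1 / (gs k) ^ 2 ≤ 1 / g ^ 2 + 3 * ((K : ℝ) - k) :=
  couplingTrajectory_exists_history βw (by norm_num) (by norm_num) (by norm_num) βw_cont βw_lower βw_upper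

/-- THE PINNED RUNS of the witness: run K solves (0.20) for `βw` on [0, K] with `g_K = 1/16`. [folklore] -/
def run (K : ℕ) : ℕ → ℝ := Classical.choose (runs_exist K (1 / 16) (by norm_num) le_rfl)

/-- Specification of the pinned runs. [folklore] -/
theorem run_spec (K : ℕ) :
    run K K = 1 / 16 ∧ RGEqH K βw (run K) ∧ ∀ k, k ≤ K → 0 < run K k ∧ run K k ≤ 1 / 16 := by
  obtain ⟨h1, h2, h3, -⟩ := Classical.choose_spec (runs_exist K (1 / 16) (by norm_num) le_rfl)
  exact ⟨h1, h2, h3⟩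

/-- **END TO END, BY NAME (kernel):** `T4BetaReadOutLipschitz.injectedRate_of_u3_on` applied to the toy scheme, its (R)
binders discharged by the gen-7 kernel `Probes.readBoundedOn_recipe` / `Probes.readCovariantOn_recipe`, its U3-shaped
binders by §3, its run binders by `run_spec`/`βw_lower`, and the smallness clause by arithmetic
(8·1·(1/4)·((1/16)³ + (1/16)/1) ≤ 1/4): the two-run discrepancies of the toy's pinned runs obey
`T4CauchySum.InjectedRate (1/8) 0 (1/2)` — node U2's output socket (node U5's binder `hinj`, degree 0) is INHABITED by data
produced from U3-shaped inputs.  A WITNESS; nothing about Bałaban's runs. [cite: Balaban1987RG1, (0.20) p.256] -/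
theorem injectedRate_witness :
    T4CauchySum.InjectedRate (1 / 8) 0 (1 / 2) (fun K j => disc (run K) (run (K + 1)) j) := by
  have hω : (0 : ℝ) ≤ 1 / 4 := by norm_num
  have h := injectedRate_of_u3_on (β := βw) (ρ := 1 / 2) (b := 2) (k₀ := 0) run (1 / 16)
    (window_toy (1 / 16)) (ne5_toy hω 1 (1 / 16) 0) (ne9_toy hω 1 (1 / 16) 0) (fadingMemory_toy hω)
    (representsA_toy (1 / 4) 1 1 (1 / 16)) (representsB_toy (1 / 4) 1 1 (1 / 16)) (analyticA_toy (1 / 4) 1 1 (1 / 16))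
    (analyticB_toy (1 / 4) 1 1 (1 / 16))
    ((toyP 1).transportTo.readBoundedOn_recipe one_pos (localitySum_toy 1 0) (idx_nonempty 1))
    ((toyP 1).readCovariantOn_recipe one_pos (localitySum_toy 1 0) (idx_nonempty 1))
    (by norm_num) (by norm_num) hω hω (by norm_num) (by norm_num) (by norm_num) (by norm_num) (by norm_num) (by norm_num)
    (fun K => (run_spec K).2.1) (fun K => (run_spec K).2.2) (fun K => (run_spec K).1)
    (fun k v _ hv => βw_lower k v hv) (by norm_num)
  have hc : (2 * (8 * |(1 : ℝ)| / 1 ^ 2 * (1 / 16 * (1 / 4)) * (1 / 4)) / (1 - 1 / 2) : ℝ) = 1 / 8 := by norm_num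
  rw [hc] at h
  exact h

/-- THE BINDER LIST OF `ne4_of_u3_recipe` IS INHABITED NON-DEGENERATELY (summary, kernel): all eleven hypotheses hold for
the toy data at (ω, c₀, wt, γ, κ, α, K) = (1/4, 1, 1, 1/16, 0, 1, 1), AND the β read off is not scale-invariant (the shift
is strictly positive on every box), AND the two runs' functionals are not equal.  [folklore] -/
theorem ne4_of_u3_recipe_binders_inhabited :
    (∀ k (v : Fin (k + 1) → ℝ), v ∈ Box (1 / 16 : ℝ) k → extd v ∈ Window (1 / 16)) ∧
    (∀ b, 0 < b → b ≤ 1 / 16 → NE5 (EA (1 / 4) 1) (EB (1 / 4) 1 b) (Window (1 / 16)) 0 (1 / 4) (1 / 16 * (1 / 4))) ∧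
    NE9 (EA (1 / 4) 1) (Window (1 / 16)) 0 (Λω (1 / 4)) ∧
    T4OutputRate.FadingMemory 1 (1 / 4) (Λω (1 / 4)) ∧
    RepresentsA (EA (1 / 4) 1) (toyP 1).transportTo.recipe (1 / 16) βw ∧
    RepresentsB (EB (1 / 4) 1) (toyP 1).recipe (1 / 16) βw ∧
    (∀ g ∈ Window (1 / 16 : ℝ), EA (1 / 4) 1 g ∈ (toyP 1).transportTo.Analytic 1) ∧
    (∀ b, 0 < b → b ≤ 1 / 16 → ∀ g ∈ Window (1 / 16 : ℝ), EB (1 / 4) 1 b g ∈ (toyP 1).Analytic 1) ∧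
    (0 : ℝ) < 1 ∧ (toyP 1).LocalitySum 0 |1| ∧ (∀ k, ((toyP 1).idx k).Nonempty) ∧
    (∀ k (w : Fin (k + 2) → ℝ), w ∈ Box (1 / 16 : ℝ) (k + 1) → 0 < βw (k + 1) w - βw k (Fin.tail w)) ∧
    ¬ NE5 (EA (1 / 4) 1) (EB (1 / 4) 1 (1 / 16)) (Window (1 / 16)) 0 (1 / 4) 0 :=
  ⟨window_toy _, ne5_toy (by norm_num) 1 _ 0, ne9_toy (by norm_num) 1 _ 0, fadingMemory_toy (by norm_num),
    representsA_toy _ 1 1 _, representsB_toy _ 1 1 _, analyticA_toy _ 1 1 _, analyticB_toy _ 1 1 _, one_pos,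
    localitySum_toy 1 0, idx_nonempty 1, fun k _ hw => βw_scaleShift_pos k hw, ne5_toy_not_zero⟩

end

end Literature.MathematicalPhysics.QuantumFieldTheory.Balaban1983to89.T4BetaReadOutWitness
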